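import Summits.MatrixMultiplication.OmegaCensus.STPPCell22Core
import Summits.MatrixMultiplication.OmegaCensus.STPPDifferenceSetCriterion
import Summits.MatrixMultiplication.OmegaCensus.STPPVosperSlackTwoLawABT
import Summits.MatrixMultiplication.OmegaCensus.STPPVosperSlackTwoSoundG

/-!
# ω-census (abelian STPP census): the CELL-(2,2) LAW of the fifth leaf `{(2,2,2),(3,3,3)²} @ ℤ₆₁` (renormalisation + the core)

HONEST FRAMING (pub-omega census; verbatim): lottery ticket; floor = certified bounds/negative ranges.
Census STRUCTURE (seat pub-omega-stpp-1 gen 33, 2026-08-29), family (b2).  `cell22_false`: in an STPP family over `ℤ/61` whose block `i` is `(3,3,3)`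
and whose other blocks have sizes `(3,3,3),(2,2,2)`, the pairs `(−Aᵢ, Y°)` and `(−Bᵢ, Z°)` cannot both be two above Cauchy–Davenport — this is
exactly the hypothesis `h22` of the slack-4 law `no_isSTPP_of_slack_four_tables_of_cell22` (`STPPVosperSlackFourLawT.lean`) for this leaf.  MODULO
(hypotheses, each a `decide +kernel` certificate being landed separately): the zoo root row `hrows` (`STPPZoo313Nodes8.zooNode_rroot`), the stage-1
rows `hS1` (`STPPCell22Stage1.c22s1_all`), stage 2 `hS2` (`plc22_real`) and the link row `hsub` (`tbl22G_sub`, both `STPPCell22Stage2`), and the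
dead table `hdead` (`c22dead_all` of `STPPCell22Dead` via `coverDead_of_existsCoverW`).  Proof = plan S1–S2 here (affine normal forms `three_set_affine_nf`, renormalisation `isSTPP_dilate`/`isSTPP_translate`, transport of sizes and sumsets), then `cell22_core` (`STPPCell22Core.lean`, S3–S8). For the record, S1–S8 =
affine normal forms of both three-point sets (`three_set_affine_nf`), renormalisation of the family (`isSTPP_dilate`, `isSTPP_translate`), the zoo on
both pairs, masks of `SY″ / T″ / W″` after translating by `−t₁` (`rep_*`, `rot_rot`, `dilMask_rot`, `tb_compl_xor_iff_of_partition`), the exact cover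
(`coverK_complete`, translates disjoint by `blockSum_inj`), the closure pre-filters (`closure_test_eq`), admissibility, `mem_plc_of_place22`,
`lookup22_of_real22`, the link row and `CoverDead` on the renormalised family.  No `decide` (beyond numerals); nothing here is progress on `ω`.

References: H. Cohn, R. Kleinberg, B. Szegedy, C. Umans, FOCS 2005, Def. 5.1; Y. O. Hamidoune, Ø. J. Rødseth, Acta Arith. 92 (2000) (context:
no two-above inverse theorem with a 3-element summand is in print — this is a finite certificate).
-/

open Finset
open scoped Pointwise

namespace Summit.MatrixMultiplication.OmegaCensus.CubeNB.S2

open Literature.Computability.AlgebraicComplexity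
open Literature.Combinatorics.Additive
open Summit.MatrixMultiplication.OmegaCensus.STPPKneser
open Summit.MatrixMultiplication.OmegaCensus.CubeNB.Bits

/-- **Cell (2,2) of the fifth leaf is dead** (modulo the zoo root row and the stage-1/2/3 rows, all being certified by `decide +kernel`):
in an STPP family over `ℤ/61` whose block `i` is `(3,3,3)` and whose other blocks are `(3,3,3),(2,2,2)`, the pairs `(−Aᵢ, Y°)` and `(−Bᵢ, Z°)` cannot
both be two above Cauchy–Davenport. [cite: CohnKleinbergSzegedyUmans2005, Def. 5.1] -/
theorem cell22_false [Fact (Nat.Prime 61)] (hrows : zooGo 61 zooTbl61 12 59 3 0 1 [0] = true) {N : ℕ} {A B C : Fin N → Finset (ZMod 61)} (hS : IsSTPP A B C)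
    (hA : ∀ k, (A k).Nonempty) (hB : ∀ k, (B k).Nonempty) (hC : ∀ k, (C k).Nonempty) (i : Fin N) (ha : #(A i) = 3) (hb : #(B i) = 3) (hc : #(C i) = 3)
    (hz : ∑ k ∈ univ.erase i, #(A k) * #(C k) = 13) (hL : ∑ k ∈ univ.erase i, #(B k) * #(C k) = 13)
    (ks : List (Fin N)) (hks : ks.Nodup) (hksi : ∀ k, k ∈ ks ↔ k ≠ i)
    (hszs : ks.map (fun k => (#(A k), #(B k), #(C k))) = [(3, 3, 3), (2, 2, 2)])
    (hS1 : ∀ b ∈ zooShp61, ∀ w ∈ List.range' 1 60, place22Row 61 zooShp61 plc22 b w = true)   -- `c22s1_all` (STPPCell22Stage1)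
    (hS2 : (plc22.all (real22 61 zooNrm61 tbl22G)) = true)                                     -- `plc22_real` (STPPCell22Stage2)
    (hsub : (tbl22G.all fun g => g.2.all fun z => tbl22F.any fun e => Nat.beq e.1 g.1 && Nat.beq e.2 z) = true)  -- `tbl22G_sub`
    (hdead : ∀ e ∈ tbl22F, CoverDead 61 N i [(3, 3, 3), (2, 2, 2)] (members (List.range 61) e.1) (members (List.range 61) e.2))
      -- from `c22dead_all` (STPPCell22Dead) + `coverDead_of_existsCoverW` with the `blockDiffsWQ` enumerator soundness
    (hSY : #((A i).image (fun x => (0 : ZMod 61) - x) + DU B C (univ.erase i)) = 17)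
    (hT : #((B i).image (fun x => (0 : ZMod 61) - x) + DU A C (univ.erase i)) = 17) : False := by
  have hp0 : (0 : ℕ) < 61 := by norm_num
  -- ── S1: affine normal forms of `−Aᵢ` and `−Bᵢ` (zoo, modulo `hrows`) ──
  have hAcard : #((A i).image fun x => (0 : ZMod 61) - x) = 3 := by rw [card_image_of_injective _ sub_right_injective, ha]
  have hBcard : #((B i).image fun x => (0 : ZMod 61) - x) = 3 := by rw [card_image_of_injective _ sub_right_injective, hb]
  have hYcard : #(DU B C (univ.erase i)) = 13 := by rw [card_DU_BC hS hA, hL]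
  have hZcard : #(DU A C (univ.erase i)) = 13 := by rw [card_DU_AC hS hB, hz]
  obtain ⟨u, tA, hu, y₀, hy₀, hAimg⟩ := three_set_affine_nf hrows _ _ hAcard hYcard hSY
  obtain ⟨u', tB, hu', y₀', hy₀', hBimg⟩ := three_set_affine_nf hrows _ _ hBcard hZcard hT
  set w : ZMod 61 := u * u'⁻¹ with hw
  have hw0 : w ≠ 0 := mul_ne_zero hu (inv_ne_zero hu')
  have hwu' : w * u' = u := by rw [hw, mul_assoc, inv_mul_cancel₀ hu', mul_one]
  clear_value w
  -- ── S2: renormalise the family: `A' = u•A − tA`, `B' = u•B − w tB`, `C' = u•C − w tB − e` ──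
  set Y₀ := (DU B C (univ.erase i)).image (fun x => u * x) with hY₀
  have hY₀card : #Y₀ = 13 := by rw [hY₀, card_image_of_injective _ (mul_right_injective₀ hu), hYcard]
  obtain ⟨e, he, he1⟩ := exists_mem_sub_not_mem (S := Y₀) (by rw [← card_pos, hY₀card]; norm_num)
    (by intro h; have := congrArg card h; rw [hY₀card, card_univ, ZMod.card] at this; norm_num at this) one_ne_zero
  set a₀ : ZMod 61 := -tA with ha₀
  set b₀ : ZMod 61 := -(w * tB) with hb₀
  set c₀ : ZMod 61 := b₀ - e with hc₀
  have hSd := isSTPP_dilate hS hu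
  have hS3 := isSTPP_translate hSd (fun _ => a₀) (b₀ - a₀) (c₀ - a₀)
  set A3 : Fin N → Finset (ZMod 61) := fun k => (A k).image (u * ·) + {a₀} with hA3
  set B3 : Fin N → Finset (ZMod 61) := fun k => (B k).image (u * ·) + {a₀ + (b₀ - a₀)} with hB3
  set C3 : Fin N → Finset (ZMod 61) := fun k => (C k).image (u * ·) + {a₀ + (c₀ - a₀)} with hC3
  have hS3' : IsSTPP A3 B3 C3 := hS3
  have hmemA3 : ∀ k x, x ∈ A3 k ↔ ∃ v ∈ A k, u * v + a₀ = x := by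
    intro k x
    simp only [hA3, mem_add, mem_singleton, mem_image]
    constructor
    · rintro ⟨_, ⟨v, hv, rfl⟩, z, rfl, rfl⟩; exact ⟨v, hv, rfl⟩
    · rintro ⟨v, hv, rfl⟩; exact ⟨u * v, ⟨v, hv, rfl⟩, a₀, rfl, rfl⟩
  have hmemB3 : ∀ k x, x ∈ B3 k ↔ ∃ v ∈ B k, u * v + b₀ = x := by
    intro k x
    simp only [hB3, mem_add, mem_singleton, mem_image, add_sub_cancel]
    constructor
    · rintro ⟨_, ⟨v, hv, rfl⟩, z, rfl, rfl⟩; exact ⟨v, hv, rfl⟩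
    · rintro ⟨v, hv, rfl⟩; exact ⟨u * v, ⟨v, hv, rfl⟩, b₀, rfl, rfl⟩
  have hmemC3 : ∀ k x, x ∈ C3 k ↔ ∃ v ∈ C k, u * v + c₀ = x := by
    intro k x
    simp only [hC3, mem_add, mem_singleton, mem_image, add_sub_cancel]
    constructor
    · rintro ⟨_, ⟨v, hv, rfl⟩, z, rfl, rfl⟩; exact ⟨v, hv, rfl⟩
    · rintro ⟨v, hv, rfl⟩; exact ⟨u * v, ⟨v, hv, rfl⟩, c₀, rfl, rfl⟩
  have hinj : ∀ t : ZMod 61, Function.Injective fun v : ZMod 61 => u * v + t := fun t v v' hh =>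
    mul_left_cancel₀ hu (add_right_cancel hh)
  have hA3eq : ∀ k, A3 k = (A k).image fun v => u * v + a₀ := fun k => by ext x; rw [hmemA3, mem_image]
  have hB3eq : ∀ k, B3 k = (B k).image fun v => u * v + b₀ := fun k => by ext x; rw [hmemB3, mem_image]
  have hC3eq : ∀ k, C3 k = (C k).image fun v => u * v + c₀ := fun k => by ext x; rw [hmemC3, mem_image]
  have hA3ne : ∀ k, (A3 k).Nonempty := fun k => by rw [hA3eq]; exact (hA _).image _
  have hB3ne : ∀ k, (B3 k).Nonempty := fun k => by rw [hB3eq]; exact (hB _).image _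
  have hC3ne : ∀ k, (C3 k).Nonempty := fun k => by rw [hC3eq]; exact (hC _).image _
  have hcardA : ∀ k, #(A3 k) = #(A k) := fun k => by rw [hA3eq, card_image_of_injective _ (hinj _)]
  have hcardB : ∀ k, #(B3 k) = #(B k) := fun k => by rw [hB3eq, card_image_of_injective _ (hinj _)]
  have hcardC : ∀ k, #(C3 k) = #(C k) := fun k => by rw [hC3eq, card_image_of_injective _ (hinj _)]
  have hszs3 : ks.map (fun k => (#(A3 k), #(B3 k), #(C3 k))) = [(3, 3, 3), (2, 2, 2)] := by
    rw [← hszs]; exact List.map_congr_left fun k _ => by rw [hcardA, hcardB, hcardC]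
  -- the renormalised difference sets
  have hY3 : DU B3 C3 (univ.erase i) = (DU B C (univ.erase i)).image fun y => u * y + (c₀ - b₀) :=
    DU_eq_image_affine u (c₀ - b₀) (fun _ => b₀) (fun _ => c₀) (fun _ => rfl) hmemB3 hmemC3 _
  have hZ3 : DU A3 C3 (univ.erase i) = (DU A C (univ.erase i)).image fun y => u * y + (c₀ - a₀) :=
    DU_eq_image_affine u (c₀ - a₀) (fun _ => a₀) (fun _ => c₀) (fun _ => rfl) hmemA3 hmemC3 _
  have hce : c₀ - b₀ = -e := by rw [hc₀]; ring
  -- (F1) `−A'ᵢ = {0, 1, y₀}`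
  have hF1 : (A3 i).image (fun x => (0 : ZMod 61) - x) = {0, 1, ((y₀ : ℕ) : ZMod 61)} := by
    rw [← hAimg, hA3eq, image_image, image_image]
    refine image_congr fun v _ => ?_
    show (0 : ZMod 61) - (u * v + a₀) = u * (0 - v) + tA
    rw [ha₀]; ring
  -- (F2) `−B'ᵢ = w • {0, 1, y₀'}`
  have hF2 : (B3 i).image (fun x => (0 : ZMod 61) - x) = ({0, 1, ((y₀' : ℕ) : ZMod 61)} : Finset (ZMod 61)).image (w * ·) := by
    rw [← hBimg, hB3eq, image_image, image_image, image_image]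
    refine image_congr fun v _ => ?_
    show (0 : ZMod 61) - (u * v + b₀) = w * (u' * (0 - v) + tB)
    rw [hb₀, ← hwu']; ring
  -- (F3) `0 ∈ Y°'`, `60 ∉ Y°'`
  have hY3' : DU B3 C3 (univ.erase i) = Y₀.image fun x => x + -e := by
    rw [hY3, hce, hY₀, image_image]; rfl
  have h0Y : (0 : ZMod 61) ∈ DU B3 C3 (univ.erase i) := by rw [hY3']; exact mem_image.2 ⟨e, he, by ring⟩
  have h60Y : (60 : ZMod 61) ∉ DU B3 C3 (univ.erase i) := by rw [hY3']; exact sixty_not_mem_image he1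
  -- (F5) the two sumsets keep their sizes
  have hSY3 : #((A3 i).image (fun x => (0 : ZMod 61) - x) + DU B3 C3 (univ.erase i)) = 17 := by
    rw [negImage_add_DU_eq_image_affine i _ u a₀ (c₀ - b₀) (hmemA3 i) hY3, card_image_of_injective _ (hinj _), hSY]
  have hT3 : #((B3 i).image (fun x => (0 : ZMod 61) - x) + DU A3 C3 (univ.erase i)) = 17 := by
    rw [negImage_add_DU_eq_image_affine i _ u b₀ (c₀ - a₀) (hmemB3 i) hZ3, card_image_of_injective _ (hinj _), hT]
  -- ── S3–S8: the core ──
  have hY3card : #(DU B3 C3 (univ.erase i)) = 13 := by rw [hY3', card_image_of_injective _ (add_left_injective _), hY₀card]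
  have hZ3card : #(DU A3 C3 (univ.erase i)) = 13 := by rw [hZ3, card_image_of_injective _ (hinj _), hZcard]
  exact cell22_core hrows hS3' hA3ne hB3ne hC3ne i (by rw [hcardA, ha]) (by rw [hcardB, hb]) (by rw [hcardC, hc]) hY3card hZ3card ks hks hksi
    hszs3 hy₀ hy₀' hw0 hF1 hF2 h0Y h60Y hSY3 hT3 hS1 hS2 hsub hdead

end Summit.MatrixMultiplication.OmegaCensus.CubeNB.S2
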